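import Summits.AtomisticToContinuum.HydrodynamicLimit.Theorems.BoxDissipativeWeakStrongFluxClosureEqHomogeneous
import Summits.AtomisticToContinuum.HydrodynamicLimit.Theorems.BoxDissipativeWeakStrongFluxClosureEqKineticIsotropy
import HarnessLib

/-!
# Collisional virial in global equilibrium — rung 0 of stub V of crux `FluxClosure`
(route `BoxDissipativeWeakStrong`, item stmt-AtomisticToContinuum-9902, line `registered`, sub-goal E9)

Support file of the lead prover. The open stub `stub_collisionalVirial` (V) of the crux skeleton asserts that the
time-integrated collisional momentum transfer `C_w` (the collision sum along the deterministic orbit, tested against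
the box average of `w`) closes on the CUT EXCESS PRESSURE `ρ̂θ̂(Z(min(ρ̂σ³,η₁)) − 1)` in `L¹(P_N)` — positive-time
contact statistics of deterministic hard spheres out of equilibrium, for which no theorem is known. This file proves
its GLOBAL-EQUILIBRIUM instance (constant profiles, homogeneous Gibbs law, every flow family, every kinetic window):
`∫⁻ |CollDev_N| dP_N → 0`. Proof: the EXACT balance identity `D_N = CollDev_N + KinDev_N` on the good set
(`FluxClosureGlue.boxMomentumBalance`, landed), the equilibrium instances `FluxClosureEq.E8.fluxClosure_homogeneous`
(`D_N → 0`) and `FluxClosureEq.E7.kineticIsotropy_homogeneous` (`KinDev_N → 0`), and the `L¹(P_N)` triangle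
inequality `FluxClosureGlue.tendsto_lintegral_abs_of_ae_eq_add`. So in equilibrium all three functionals of the
line (defect, kinetic deviation, collisional deviation) vanish in `L¹(P_N)` along the deterministic dynamics.

References: H. Spohn, *Large Scale Dynamics of Interacting Particles* (1991), Part I §2.3, §3.2–3.3 ((3.15)).
-/

noncomputable section

namespace Summit.AtomisticToContinuum.HydrodynamicLimit.Theorems
namespace FluxClosureEq.E9

open scoped BigOperators Topology Classical MeasureTheory ProbabilityTheory InnerProductSpace ENNReal
open Filter Set Function MeasureTheory
open Literature.MathematicalPhysics.KineticTheory Literature.Analysis.FluidPDE Literature.Analysis.FunctionSpaces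
open Summit.AtomisticToContinuum.HydrodynamicLimit.Theses.BoxDissipativeWeakStrong
open Summit.AtomisticToContinuum.HydrodynamicLimit.Theorems.EntropyClockDock (ae_mem_good_localGibbsLaw)

/-- **Collisional virial in global equilibrium (rung 0 of stub V; registered sub-goal E9).** Given the hard-sphere
EOS fact, there is `η_c > 0` such that for every band `0 < η₁ < η_c`, all CONSTANT profiles `a, θ > 0`, `u`, there
is `σ₀ > 0` such that for all `0 < σ < σ₀`, every horizon `T`, EVERY hard-sphere flow family and every kinetic window,
for `τ ∈ [0,T)` and every `w` smooth on `[0,T) × 𝕋³`: the collisional deviation of the crux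
(`C_w − ∫_{(0,τ]}∫ ρ̂θ̂ (Z(min(ρ̂σ³,η₁)) − 1) div w`, verbatim the functional of `stub_collisionalVirial`) tends to `0` in
`L¹` of the homogeneous local Gibbs law. Proof: module docstring. -/
theorem collisionalVirial_homogeneous : HsEosLowDensity → ∃ ηc : ℝ, 0 < ηc ∧ ∀ η₁ : ℝ, 0 < η₁ → η₁ < ηc → ∀ (a θ : ℝ) (u : V3), 0 < a → 0 < θ → ∃ σ₀ : ℝ, 0 < σ₀ ∧ ∀ σ : ℝ, 0 < σ → σ < σ₀ → ∀ (T : ℝ) (Φ : (N : ℕ) → HardSphereFlow (Torus.geometry (Fin 3)) (hsDiameter σ N) (N + 1)) (ℓ : ℕ → ℝ), (∀ N, 0 < ℓ N ∧ ℓ N ≤ 1) → Tendsto ℓ atTop (𝓝 0) → Tendsto (fun N : ℕ => ℓ N ^ 3 * ((N : ℝ) + 1)) atTop atTop → let K := fun (l : ℝ) (x y : T3) => indicator {y' : T3 | ∀ i, ‖y' i - x i‖ < l / 2} (fun _ => (l ^ 3)⁻¹) y; let Dn := fun N t z x => empiricalDensityField ((Φ N).flow t z) (K (ℓ N) x); let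 Mm := fun N t z x => empiricalMomentumField ((Φ N).flow t z) (K (ℓ N) x); let En := fun N t z x => empiricalEnergyField ((Φ N).flow t z) (K (ℓ N) x); let Th := fun (r : ℝ) (m : V3) (E : ℝ) => 2 / 3 * (E / r - ‖m‖ ^ 2 / (2 * r ^ 2)); let Zc := fun η : ℝ => hsCompressibility (min η η₁); ∀ τ ∈ Ico 0 T, ∀ w : ℝ → T3 → V3, Torus.IsSmoothSpaceTimeOn (Ico 0 T) w → let Cw := fun N (z : Config (N + 1) (Fin 3) T3) => ∑ᶠ t ∈ collisionTimes (Torus.geometry (Fin 3)) (hsDiameter σ N) (fun s => (Φ N).flow s z) ∩ Ioc 0 τ, collisionJump (fun z' : Config (N + 1) (Fin 3) T3 => ((N : ℝ) + 1)⁻¹ * momentumObservable (fun q => ∫ x, K (ℓ N) x q • w t x) z') (fun s => (Φ N).flow s z) t; Tendsto (fun N : ℕ => ∫⁻ z, ENNReal.ofReal (|Cw N z - ∫ t in Ioc 0 τ, ∫ x, Dn N t z x * Th (Dn N t z x) (Mm N t z x) (En N t z x) * (Zc (Dn N t z x * σ ^ 3) - 1) * Torus.divergence (w t) x|) ∂(localGibbsLaw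 σ (fun _ => a) (fun _ => u) (fun _ => θ) N (Φ N))) atTop (𝓝 0) := by
  intro hEos
  obtain ⟨ηc, hηc, H8⟩ := FluxClosureEq.E8.fluxClosure_homogeneous hEos
  refine ⟨ηc, hηc, ?_⟩
  intro η₁ hη₁ hη₁c a θ u ha hθ
  obtain ⟨σ₀, hσ₀, H8'⟩ := H8 η₁ hη₁ hη₁c a θ u ha hθ
  refine ⟨min σ₀ (1 / 2), lt_min hσ₀ (by norm_num), ?_⟩
  intro σ hσ hσlt T Φ ℓ hℓ hℓ0 hℓ3
  have hσ₀' : σ < σ₀ := lt_of_lt_of_le hσlt (min_le_left _ _)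
  have hσ2 : σ ≤ 1 / 2 := (lt_of_lt_of_le hσlt (min_le_right _ _)).le
  have hD := H8' σ hσ hσ₀' T Φ ℓ hℓ hℓ0 hℓ3
  have hK := FluxClosureEq.E7.kineticIsotropy_homogeneous σ a θ u hσ hσ2 ha hθ T Φ ℓ hℓ hℓ3
  have hBal := FluxClosureGlue.boxMomentumBalance σ η₁ T (fun _ => a) (fun _ => θ) (fun _ => u) Φ ℓ hℓ
  dsimp only at hD hK hBal ⊢
  intro τ hτ w hw
  have hD' := hD τ hτ w hw
  have hK' := hK τ hτ w hw
  have hB' := hBal τ hτ w hw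
  refine FluxClosureGlue.tendsto_lintegral_abs_of_ae_eq_add
    (fun N => localGibbsLaw σ (fun _ => a) (fun _ => u) (fun _ => θ) N (Φ N)) _ _ _
    (fun N => ?_) (fun N => ((hB' N).1).const_mul (-1)) hD' ?_
  · filter_upwards [ae_mem_good_localGibbsLaw σ (fun _ => a) (fun _ => θ) (fun _ => u) N (Φ N)] with z hz
    have h := (hB' N).2 z hz
    rw [h]
    ring
  · simpa only [neg_one_mul, abs_neg] using hK'

end FluxClosureEq.E9
end Summit.AtomisticToContinuum.HydrodynamicLimit.Theorems

end
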